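import Mathlib
import Summits.ValiantsHypothesis.ValiantsHypothesis.Theorems.DivisionGapDefs
import Summits.ValiantsHypothesis.ValiantsHypothesis.Theorems.DivisionGapPerMultiplesHardStubFaceDescent
import Summits.ValiantsHypothesis.ValiantsHypothesis.Theorems.DivisionGapPerCofactorDegreeReductionStubBlockProjection
import Summits.ValiantsHypothesis.ValiantsHypothesis.Theorems.DivisionGapPerCofactorDegreeReductionStubBlockFibre
import Summits.ValiantsHypothesis.ValiantsHypothesis.Theorems.DivisionGapPerCofactorDegreeReductionStubIsolatedStrip
import Literature.Computability.AlgebraicComplexity.ValiantClassesProofs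
import Literature.Computability.AlgebraicComplexity.PermanentIrreducible

/-!
# `DivisionGap.PerCofactorDegreeReduction` (stmt-ValiantsHypothesis-15046), line `Sketch_ideator4`:
the YOUNG HALVING rung (stub `stub_youngHalvingRung`, U)

Rows `V = eV(Fin m)` and columns `U = eU(Fin m)` (`eV`, `eU` injective) determine the Young face
`G = V × U ∪ Vᶜ × Uᶜ` of the Birkhoff polytope, cut out by the indicator weight `w = 1_G`
(`cutsOut`: a permutation has `w`-weight `n` iff all its cells lie in `G`, and such permutations
exist, `exists_extending`).  For a multiplier `h ≠ 0` over `ℝ≥0`: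

1. top components are free and multiplicative (`complexity_topComponent_le`, `topComponent_mul`),
   and `top_w per_n = per_G` (`FaceDescent.topComponent_perPoly_eq`), so
   `L(per_G · top_w h) ≤ L(per_n · h)`;
2. the substitution `x_{(eV a, eU b)} ↦ X_{(a, b)}`, every variable off the block `V × U ↦ 1`
   (`exists_subst`) is a Valiant projection (free, `complexity_le_of_isProjection`); it sends
   `per_G` to `c • per_m` with `c ≥ 1` the common size of the fibres of the restriction of the
   permutations inside `G` to the block (`aeval_facePer_eq`; the fibres are translates of one
   another by row permutations of `V`, `exists_rowPerm`), and `top_w h` to the polynomial `h'`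
   whose monomials are the block restrictions of the monomials of `top_w h`
   (`mem_support_aeval_iff`, no cancellation over `ℝ≥0`, `BlockFibre.mem_support_sum_monomial_iff`);
3. unscaling `c` costs one gate (`IsolatedStrip.complexity_le_complexity_smul_add_one`).

Hence `L(per_m · h') ≤ L(per_n · h) + 1`.  No definitions: the substitution and the permutations
enter the lemmas as parameters characterised by hypotheses. [folklore]
-/

noncomputable section

-- `Summit.ValiantsHypothesis.ValiantsHypothesis.…` is the tree's mandated single-conjunct layout
-- (Sub = Summit), so the duplicated namespace component is intended.
set_option linter.dupNamespace false

open MvPolynomial Literature.Computability.AlgebraicComplexity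
open Summit.ValiantsHypothesis.ValiantsHypothesis.Theorems.ZeroOneTransfer.Negative (topComponent)
open Summit.ValiantsHypothesis.ValiantsHypothesis.Theorems.DivisionGapPerDivisionHard (facePer)
open Summit.ValiantsHypothesis.ValiantsHypothesis.Theorems.DivisionGap.PerCofactorDegreeReduction.GadgetProjection
  (monomial_permMonomial_eq_prod)
open scoped NNReal

namespace Summit.ValiantsHypothesis.ValiantsHypothesis.Theorems.DivisionGap.PerCofactorDegreeReduction.YoungHalving

variable {n m : ℕ} {eV eU : Fin m → Fin n}

/-! ### Permutations through two injections -/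

/-- Two injections `f g : Fin m → Fin n` are interpolated by a permutation `τ` of `Fin n`
(`Equiv.Perm.exists_extending_pair`), and then `τ x` lies in the range of `g` iff `x` lies in the
range of `f` (`τ` is injective). [folklore] -/
theorem exists_extending {f g : Fin m → Fin n} (hf : Function.Injective f)
    (hg : Function.Injective g) :
    ∃ τ : Equiv.Perm (Fin n), (∀ b, τ (f b) = g b) ∧ ∀ x, ((∃ a, g a = τ x) ↔ ∃ b, f b = x) := by
  obtain ⟨τ, hτ⟩ := Equiv.Perm.exists_extending_pair f g hf hg
  refine ⟨τ, hτ, fun x => ⟨?_, ?_⟩⟩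
  · rintro ⟨a, ha⟩
    exact ⟨a, τ.injective ((hτ a).trans ha)⟩
  · rintro ⟨b, rfl⟩
    exact ⟨b, (hτ b).symm⟩

/-- A permutation `g` of `Fin m` is induced on the rows `eV(Fin m)` by a permutation `ρ` of `Fin n`
preserving the range of `eV`. [folklore] -/
theorem exists_rowPerm (hV : Function.Injective eV) (g : Equiv.Perm (Fin m)) :
    ∃ ρ : Equiv.Perm (Fin n), (∀ a, ρ (eV a) = eV (g a)) ∧
      ∀ x, ((∃ a, eV a = ρ x) ↔ ∃ a, eV a = x) := by
  obtain ⟨ρ, hρ, hρV⟩ :=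
    exists_extending (g := fun a => eV (g a)) hV fun a b h => g.injective (hV h)
  refine ⟨ρ, hρ, fun x => ?_⟩
  rw [← hρV x]
  exact ⟨fun ⟨a, ha⟩ => ⟨g.symm a, by simpa using ha⟩, fun ⟨a, ha⟩ => ⟨g a, ha⟩⟩

/-! ### The indicator weight cuts out the Young face -/

/-- **The indicator weight of the Young face cuts it out.**  Every cell weighs at most `1`, a
permutation inside the face weighs `n`, and permutations inside the face exist
(`exists_extending`), so a permutation has maximal weight iff all its cells lie in the face.
[folklore] -/
theorem cutsOut (hV : Function.Injective eV) (hU : Function.Injective eU)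
    (σ : Equiv.Perm (Fin n)) :
    (∀ i, (σ i, i) ∈ Finset.univ.filter
        (fun e : Fin n × Fin n => (∃ a, eV a = e.1) ↔ (∃ b, eU b = e.2))) ↔
      ∀ τ : Equiv.Perm (Fin n),
        (∑ i, (if ((∃ a, eV a = τ i) ↔ (∃ b, eU b = i)) then 1 else 0 : ℕ)) ≤
          ∑ i, (if ((∃ a, eV a = σ i) ↔ (∃ b, eU b = i)) then 1 else 0 : ℕ) := by
  simp only [Finset.mem_filter, Finset.mem_univ, true_and]
  constructor
  · intro hσ τ
    exact Finset.sum_le_sum fun i _ => by rw [if_pos (hσ i)]; split_ifs <;> omega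
  · intro hmax
    obtain ⟨τ, -, hτG⟩ := exists_extending hU hV
    by_contra hσ
    obtain ⟨i, hi⟩ := not_forall.1 hσ
    refine absurd (hmax τ) (not_le.2 (Finset.sum_lt_sum (fun j _ => ?_) ⟨i, Finset.mem_univ _, ?_⟩))
    · rw [if_pos (hτG j)]; split_ifs <;> omega
    · rw [if_neg hi, if_pos (hτG i)]; exact Nat.one_pos

/-! ### The block substitution -/

-- adapted from `BlockProjection.exists_subst`
/-- **The block substitution exists** and is a Valiant projection: `x_{(eV a, eU b)} ↦ X_{(a, b)}`,
every variable off the block `↦ 1`. [folklore] -/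
theorem exists_subst (hV : Function.Injective eV) (hU : Function.Injective eU) :
    ∃ φ : Fin n × Fin n → MvPolynomial (Fin m × Fin m) ℝ≥0,
      (∀ e, (∃ j, φ e = X j) ∨ ∃ c, φ e = C c) ∧
      (∀ a b, φ (eV a, eU b) = X (a, b)) ∧
      (∀ e, (∀ p : Fin m × Fin m, e ≠ (eV p.1, eU p.2)) → φ e = 1) := by
  classical
  refine ⟨fun e => if h : ∃ p : Fin m × Fin m, e = (eV p.1, eU p.2) then X h.choose else 1,
    fun e => ?_, fun a b => ?_, fun e he => ?_⟩
  · by_cases h : ∃ p : Fin m × Fin m, e = (eV p.1, eU p.2)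
    · exact Or.inl ⟨h.choose, by simp only [dif_pos h]⟩
    · exact Or.inr ⟨1, by simp only [dif_neg h, C_1]⟩
  · have h : ∃ p : Fin m × Fin m, (eV a, eU b) = (eV p.1, eU p.2) := ⟨(a, b), rfl⟩
    have hp : h.choose = (a, b) := by
      obtain ⟨h1, h2⟩ := Prod.mk.inj h.choose_spec
      exact Prod.ext (hV h1).symm (hU h2).symm
    simp only [dif_pos h, hp]
  · have h : ¬ ∃ p : Fin m × Fin m, e = (eV p.1, eU p.2) := fun ⟨p, hp⟩ => he p hp
    simp only [dif_neg h]

/-- The block substitution sends `c · x^v` to `c · x^{v|block}`, `v|block (a, b) = v (eV a, eU b)`: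
the variables off the block go to `1`. [folklore] -/
theorem aeval_monomial_restrict (hV : Function.Injective eV) (hU : Function.Injective eU)
    {φ : Fin n × Fin n → MvPolynomial (Fin m × Fin m) ℝ≥0}
    (hφX : ∀ a b, φ (eV a, eU b) = X (a, b))
    (hφ1 : ∀ e, (∀ p : Fin m × Fin m, e ≠ (eV p.1, eU p.2)) → φ e = 1)
    (v : (Fin n × Fin n) →₀ ℕ) (c : ℝ≥0) :
    aeval φ (monomial v c) =
      monomial (Finsupp.equivFunOnFinite.symm fun q : Fin m × Fin m => v (eV q.1, eU q.2)) c := by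
  rw [aeval_monomial, algebraMap_eq, monomial_eq, Finsupp.prod_fintype _ _ fun _ => pow_zero _,
    Finsupp.prod_fintype _ _ fun _ => pow_zero _]
  congr 1
  simp only [Finsupp.coe_equivFunOnFinite_symm]
  symm
  rw [← Finset.prod_subset (Finset.subset_univ
      (Finset.univ.image fun q : Fin m × Fin m => (eV q.1, eU q.2))),
    Finset.prod_image fun p _ q _ h => Prod.ext (hV (Prod.mk.inj h).1) (hU (Prod.mk.inj h).2)]
  · refine Finset.prod_congr rfl fun q _ => ?_
    obtain ⟨a, b⟩ := q
    rw [hφX]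
  · intro e _ he
    rw [hφ1 e fun q hq => he (Finset.mem_image.2 ⟨q, Finset.mem_univ _, hq.symm⟩), one_pow]

/-- **No cancellation over `ℝ≥0`**: the monomials of the image of `p` under the block substitution
are exactly the block restrictions of the monomials of `p`. [folklore] -/
theorem mem_support_aeval_iff (hV : Function.Injective eV) (hU : Function.Injective eU)
    {φ : Fin n × Fin n → MvPolynomial (Fin m × Fin m) ℝ≥0}
    (hφX : ∀ a b, φ (eV a, eU b) = X (a, b))
    (hφ1 : ∀ e, (∀ p : Fin m × Fin m, e ≠ (eV p.1, eU p.2)) → φ e = 1)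
    (p : MvPolynomial (Fin n × Fin n) ℝ≥0) (w : (Fin m × Fin m) →₀ ℕ) :
    w ∈ (aeval φ p).support ↔ ∃ v ∈ p.support, ∀ a b, w (a, b) = v (eV a, eU b) := by
  have hsum : aeval φ p = ∑ v ∈ p.support, monomial
      (Finsupp.equivFunOnFinite.symm fun q : Fin m × Fin m => v (eV q.1, eU q.2)) (coeff v p) := by
    conv_lhs => rw [p.as_sum]
    rw [map_sum]
    exact Finset.sum_congr rfl fun v _ => aeval_monomial_restrict hV hU hφX hφ1 v _
  rw [hsum, BlockFibre.mem_support_sum_monomial_iff _ _ _ _ fun v hv => mem_support_iff.1 hv]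
  refine exists_congr fun v => and_congr_right fun _ => ?_
  rw [DFunLike.ext_iff]
  simp only [Finsupp.coe_equivFunOnFinite_symm, Prod.forall]
  exact forall₂_congr fun a b => eq_comm

/-! ### The image of the face permanent -/

/-- The block substitution sends the monomial of a permutation `σ` restricting to the permutation
`g` on the block columns (`σ (eU b) = eV (g b)`) to `x^{μ_g}`: the factors off the block columns
are `1`. [folklore] -/
theorem aeval_monomial_permMonomial (hU : Function.Injective eU)
    {φ : Fin n × Fin n → MvPolynomial (Fin m × Fin m) ℝ≥0}
    (hφX : ∀ a b, φ (eV a, eU b) = X (a, b))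
    (hφ1 : ∀ e, (∀ p : Fin m × Fin m, e ≠ (eV p.1, eU p.2)) → φ e = 1)
    {σ : Equiv.Perm (Fin n)} {g : Equiv.Perm (Fin m)} (hg : ∀ b, σ (eU b) = eV (g b)) :
    aeval φ (monomial (permMonomial σ) (1 : ℝ≥0)) = monomial (permMonomial g) (1 : ℝ≥0) := by
  rw [monomial_permMonomial_eq_prod, monomial_permMonomial_eq_prod, map_prod]
  simp_rw [aeval_X]
  symm
  rw [← Finset.prod_subset (Finset.subset_univ (Finset.univ.image eU)),
    Finset.prod_image fun b₁ _ b₂ _ h => hU h]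
  · exact Finset.prod_congr rfl fun b _ => by rw [hg, hφX]
  · intro i _ hi
    exact hφ1 _ fun p hp =>
      hi (Finset.mem_image.2 ⟨p.2, Finset.mem_univ _, ((Prod.mk.inj hp).2).symm⟩)

/-- **The block substitution sends `per_G` to `c • per_m`**, `c` the number of permutations inside
the Young face `G` restricting to the identity on the block columns.  A permutation inside `G`
maps the block columns into the block rows, hence restricts to a permutation `g` of `Fin m`
(`BlockProjection.exists_perm_of_designated`) and is sent to `x^{μ_g}`
(`aeval_monomial_permMonomial`); the fibre over `g` is the left translate of the fibre over `1`
by a permutation of `Fin n` inducing `g` on the block rows and preserving them (`exists_rowPerm`),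
so all fibres have `c` elements. [folklore] -/
theorem aeval_facePer_eq (hV : Function.Injective eV) (hU : Function.Injective eU)
    {φ : Fin n × Fin n → MvPolynomial (Fin m × Fin m) ℝ≥0}
    (hφX : ∀ a b, φ (eV a, eU b) = X (a, b))
    (hφ1 : ∀ e, (∀ p : Fin m × Fin m, e ≠ (eV p.1, eU p.2)) → φ e = 1) :
    aeval φ (facePer (Finset.univ.filter
        fun e : Fin n × Fin n => (∃ a, eV a = e.1) ↔ (∃ b, eU b = e.2))) =
      ((Finset.univ.filter fun τ : Equiv.Perm (Fin n) =>
          (∀ i, (∃ a, eV a = τ i) ↔ (∃ b, eU b = i)) ∧ ∀ b, τ (eU b) = eV b).card : ℝ≥0) •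
        perPoly (Fin m) ℝ≥0 := by
  classical
  -- a permutation inside the face restricts to a permutation of `Fin m` on the block columns
  have hres : ∀ σ : Equiv.Perm (Fin n), ∃ g : Equiv.Perm (Fin m),
      (∀ i, (∃ a, eV a = σ i) ↔ (∃ b, eU b = i)) → ∀ b, σ (eU b) = eV (g b) := by
    intro σ
    by_cases hσ : ∀ i, (∃ a, eV a = σ i) ↔ (∃ b, eU b = i)
    · obtain ⟨g, hg⟩ := BlockProjection.exists_perm_of_designated hU (σ := σ) (er := eV)
        fun b => by
          obtain ⟨a, ha⟩ := (hσ (eU b)).2 ⟨b, rfl⟩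
          exact ⟨a, ha.symm⟩
      exact ⟨g, fun _ => hg⟩
    · exact ⟨1, fun h => absurd h hσ⟩
  choose res hres using hres
  rw [facePer, map_sum, perPoly_eq_sum_monomial, Finset.smul_sum]
  set S := Finset.univ.filter fun σ : Equiv.Perm (Fin n) => ∀ i, (σ i, i) ∈ Finset.univ.filter
      fun e : Fin n × Fin n => (∃ a, eV a = e.1) ↔ (∃ b, eU b = e.2) with hSdef
  have hS : ∀ σ, σ ∈ S ↔ ∀ i, (∃ a, eV a = σ i) ↔ (∃ b, eU b = i) := fun σ => by
    simp only [hSdef, Finset.mem_filter, Finset.mem_univ, true_and]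
  have h1 : ∀ σ ∈ S, aeval φ (monomial (permMonomial σ) (1 : ℝ≥0)) =
      monomial (permMonomial (res σ)) (1 : ℝ≥0) :=
    fun σ hσ => aeval_monomial_permMonomial hU hφX hφ1 (hres σ ((hS σ).1 hσ))
  rw [Finset.sum_congr rfl h1, ← Finset.sum_fiberwise S res]
  refine Finset.sum_congr rfl fun π _ => ?_
  rw [Finset.sum_congr rfl (g := fun _ => monomial (permMonomial π) (1 : ℝ≥0))
      fun σ hσ => by rw [(Finset.mem_filter.1 hσ).2],
    Finset.sum_const, ← Nat.cast_smul_eq_nsmul ℝ≥0]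
  congr 2
  -- the fibre over `π` is the left translate by `ρ` of the fibre over `1`
  symm
  obtain ⟨ρ, hρ, hρV⟩ := exists_rowPerm hV π
  refine Finset.card_equiv (Equiv.mulLeft ρ) fun σ => ?_
  simp only [hSdef, Finset.mem_filter, Finset.mem_univ, true_and, Equiv.coe_mulLeft,
    Equiv.Perm.mul_apply]
  constructor
  · rintro ⟨hG, hb⟩
    have hG' : ∀ i, (∃ a, eV a = (ρ * σ) i) ↔ ∃ b, eU b = i := fun i => (hρV _).trans (hG i)
    refine ⟨hG', Equiv.ext fun b => hV ?_⟩
    rw [← hres _ hG', Equiv.Perm.mul_apply, hb, hρ]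
  · rintro ⟨hG', hπ⟩
    refine ⟨fun i => (hρV _).symm.trans (hG' i), fun b => ρ.injective ?_⟩
    rw [hρ, ← Equiv.Perm.mul_apply, hres (ρ * σ) hG', hπ]

/-! ### The stub -/

/-- **Young halving rung (stub `stub_youngHalvingRung`, U, of line `Sketch_ideator4`).**  For
injections `eV, eU : Fin m → Fin n` (rows `V`, columns `U`) and a multiplier `h ≠ 0` over `ℝ≥0`
there is `h' ≠ 0` on the `m × m` block, whose monomials are exactly the block restrictions of the
monomials of the top component of `h` along the indicator weight of the Young face
`V × U ∪ Vᶜ × Uᶜ`, with `L(per_m · h') ≤ L(per_n · h) + 1`: pass to top components (free and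
multiplicative over `ℝ≥0`; `top per_n = per_G` since the weight cuts out the face, `cutsOut`,
`FaceDescent.topComponent_perPoly_eq`), substitute `1` for every variable off the block (a
projection, free; `per_G ↦ c • per_m` with `c ≥ 1`, `aeval_facePer_eq`; `top h ↦ h'`,
`mem_support_aeval_iff`), and unscale `c` (one gate,
`IsolatedStrip.complexity_le_complexity_smul_add_one`). [folklore] -/
theorem stub_youngHalvingRung :
    ∀ (n m : ℕ) (eV eU : Fin m → Fin n) (h : MvPolynomial (Fin n × Fin n) ℝ≥0),
      Function.Injective eV → Function.Injective eU → h ≠ 0 →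
      ∃ h' : MvPolynomial (Fin m × Fin m) ℝ≥0, h' ≠ 0 ∧
        (∀ w : (Fin m × Fin m) →₀ ℕ, w ∈ h'.support ↔
          ∃ v ∈ (topComponent (fun e : Fin n × Fin n =>
              if ((∃ a, eV a = e.1) ↔ (∃ b, eU b = e.2)) then 1 else 0) h).support,
            ∀ a b, w (a, b) = v (eV a, eU b)) ∧
        complexity (perPoly (Fin m) ℝ≥0 * h') ≤ complexity (perPoly (Fin n) ℝ≥0 * h) + 1 := by
  intro n m eV eU h hV hU hh
  obtain ⟨φ, hproj, hφX, hφ1⟩ := exists_subst hV hU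
  set w : Fin n × Fin n → ℕ :=
    fun e => if ((∃ a, eV a = e.1) ↔ (∃ b, eU b = e.2)) then 1 else 0
  have hsupp := mem_support_aeval_iff hV hU hφX hφ1 (topComponent w h)
  refine ⟨aeval φ (topComponent w h), ?_, hsupp, ?_⟩
  · -- `h' ≠ 0`: the restriction of a top monomial of `h` occurs
    obtain ⟨v, hv⟩ := support_nonempty.2 (ZeroOneTransfer.Negative.topComponent_ne_zero w hh)
    set w' : (Fin m × Fin m) →₀ ℕ :=
      Finsupp.equivFunOnFinite.symm fun q : Fin m × Fin m => v (eV q.1, eU q.2)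
    exact support_nonempty.1 ⟨w', (hsupp w').2 ⟨v, hv, fun a b => rfl⟩⟩
  · -- the complexity bound
    set G := Finset.univ.filter
      fun e : Fin n × Fin n => (∃ a, eV a = e.1) ↔ (∃ b, eU b = e.2)
    -- (1) top components: free and multiplicative, `top per_n = per_G`
    have htop : topComponent w (perPoly (Fin n) ℝ≥0) = facePer G :=
      PerMultiplesHard.FaceDescent.topComponent_perPoly_eq G w (cutsOut hV hU)
    have h1 : complexity (facePer G * topComponent w h) ≤
        complexity (perPoly (Fin n) ℝ≥0 * h) := by
      rw [← htop, ← ZeroOneTransfer.Negative.topComponent_mul]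
      exact ZeroOneTransfer.Negative.complexity_topComponent_le w _
    -- (2) the block substitution: `per_G ↦ c • per_m`, `top h ↦ h'`
    set c : ℕ := (Finset.univ.filter fun τ : Equiv.Perm (Fin n) =>
      (∀ i, (∃ a, eV a = τ i) ↔ (∃ b, eU b = i)) ∧ ∀ b, τ (eU b) = eV b).card
    have hface : aeval φ (facePer G) = (c : ℝ≥0) • perPoly (Fin m) ℝ≥0 :=
      aeval_facePer_eq hV hU hφX hφ1
    have hc0 : (c : ℝ≥0) ≠ 0 := by
      obtain ⟨τ, hτ, hτG⟩ := exists_extending hU hV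
      exact Nat.cast_ne_zero.2
        (Finset.card_pos.2 ⟨τ, Finset.mem_filter.2 ⟨Finset.mem_univ _, hτG, hτ⟩⟩).ne'
    have h2 : complexity ((c : ℝ≥0) • (perPoly (Fin m) ℝ≥0 * aeval φ (topComponent w h))) ≤
        complexity (facePer G * topComponent w h) := by
      refine complexity_le_of_isProjection ⟨φ, hproj, ?_⟩
      rw [map_mul, hface, smul_mul_assoc]
    -- (3) unscaling costs one gate
    have h3 := IsolatedStrip.complexity_le_complexity_smul_add_one hc0
      (perPoly (Fin m) ℝ≥0 * aeval φ (topComponent w h))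
    omega

end Summit.ValiantsHypothesis.ValiantsHypothesis.Theorems.DivisionGap.PerCofactorDegreeReduction.YoungHalving

end
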